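import Mathlib.Combinatorics.SimpleGraph.Walk.Basic
import Mathlib.Combinatorics.SimpleGraph.Walk.Operations
import HarnessLib

/-!
# Runs of a walk inside the pieces of a vertex partition: a discrete intermediate value lemma

Topic `Literature/Combinatorics/SimpleGraph`. The combinatorial core of the GLUING OF CUTSETS along a
tiling (flow constants through cylinders: Kesten 1987; Rossignol–Théret 2010, §4, "patch together"
cutsets of sub-cylinders plus the edges near the common boundaries; Dembin 2020, Lemma 4.1): the
vertices of a graph `H` are distributed into pieces (`piece : X → ι`) and carry an integer label
(`lab : X → ℤ`, the height); suppose that along a walk every step between DIFFERENT pieces joins two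
vertices with the same NON-ZERO label (crossing edges are "horizontal, off the equator"). If the
walk starts at a vertex of negative label and ends at a vertex of positive label, then some RUN of
the walk — a sub-walk staying inside one piece — goes from a negative vertex to a positive vertex,
and both ends of that run are "frontier" vertices (the endpoints of the walk, or vertices adjacent
to another piece). Applied to a cylinder tiled by sub-cylinders with their pinned cutsets removed,
the run is a bottom-to-top crossing of one sub-cylinder avoiding its cutset — a contradiction; this
is how the union of the sub-cutsets plus the equatorial seam edges is shown to be a cutset.

* `exists_run_of_neg_of_pos` — the lemma (with an auxiliary accumulator version
  `exists_run_of_neg_of_pos_aux`).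

Folklore (`[folklore]` tags); the module docstring records the intended use.
-/

namespace Literature.Combinatorics.SimpleGraph

open _root_.SimpleGraph

universe u v

variable {X : Type u} {ι : Type v} {H : _root_.SimpleGraph X}

/-- **Runs lemma, accumulator form.** `r` is the current run (a walk inside the piece of `u`, from a
negative frontier vertex `u`), `w` the rest of the walk; crossing steps of `w` join equal non-zero
labels; the final vertex is positive and frontier. Then some run from a negative frontier vertex to
a positive frontier vertex exists, inside one piece, using only edges of `r` and `w`. [folklore] -/
theorem exists_run_of_neg_of_pos_aux (piece : X → ι) (lab : X → ℤ) (Fr : X → Prop)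
    (hFr : ∀ z z' : X, H.Adj z z' → piece z ≠ piece z' → Fr z ∧ Fr z')
    {u : X} (hu : lab u < 0) (hFu : Fr u) :
    ∀ {x y : X} (r : H.Walk u x) (w : H.Walk x y),
      (∀ z ∈ r.support, piece z = piece u) →
      (∀ a b : X, s(a, b) ∈ w.edges → piece a ≠ piece b → lab a = lab b ∧ lab a ≠ 0) →
      0 < lab y → Fr y →
      ∃ (i : ι) (a b : X) (q : H.Walk a b), (∀ z ∈ q.support, piece z = i) ∧
        (∀ e ∈ q.edges, e ∈ r.edges ∨ e ∈ w.edges) ∧ lab a < 0 ∧ 0 < lab b ∧ Fr a ∧ Fr b := by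
  intro x y r w
  induction w generalizing u with
  | nil =>
    intro hr _ hy hFy
    exact ⟨piece u, u, _, r, hr, fun e he => Or.inl he, hu, hy, hFu, hFy⟩
  | cons h w ih =>
    rename_i x x' y
    intro hr hcross hy hFy
    have hcross' : ∀ a b : X, s(a, b) ∈ w.edges → piece a ≠ piece b → lab a = lab b ∧ lab a ≠ 0 :=
      fun a b hab => hcross a b (by rw [Walk.edges_cons]; exact List.mem_cons_of_mem _ hab)
    have hx : piece x = piece u := hr x r.end_mem_support
    by_cases hp : piece x' = piece x
    · -- the run continues
      obtain ⟨i, a, b, q, hq, hqe, ha, hb, hFa, hFb⟩ :=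
        ih hu hFu (r.concat h) (fun z hz => by
          rw [Walk.support_concat, List.mem_append, List.mem_singleton] at hz
          rcases hz with hz | rfl
          · exact hr z hz
          · rw [hp, hx]) hcross' hy hFy
      refine ⟨i, a, b, q, hq, fun e he => ?_, ha, hb, hFa, hFb⟩
      rcases hqe e he with h' | h'
      · rw [Walk.edges_concat, List.concat_eq_append, List.mem_append, List.mem_singleton] at h'
        rcases h' with h' | rfl
        · exact Or.inl h'
        · exact Or.inr (by rw [Walk.edges_cons]; exact List.mem_cons_self)
      · exact Or.inr (by rw [Walk.edges_cons]; exact List.mem_cons_of_mem _ h')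
    · -- a crossing step `x → x'`
      obtain ⟨hlab, hne⟩ := hcross x x' (by rw [Walk.edges_cons]; exact List.mem_cons_self)
        (fun h' => hp h'.symm)
      obtain ⟨hFx, hFx'⟩ := hFr x x' h (fun h' => hp h'.symm)
      rcases lt_or_gt_of_ne hne with hneg | hpos
      · -- negative crossing: start a new run at `x'`
        obtain ⟨i, a, b, q, hq, hqe, ha, hb, hFa, hFb⟩ :=
          ih (u := x') (hlab ▸ hneg) hFx' Walk.nil (fun z hz => by
            rw [Walk.support_nil, List.mem_singleton] at hz; rw [hz]) hcross' hy hFy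
        refine ⟨i, a, b, q, hq, fun e he => ?_, ha, hb, hFa, hFb⟩
        rcases hqe e he with h' | h'
        · simp at h'
        · exact Or.inr (by rw [Walk.edges_cons]; exact List.mem_cons_of_mem _ h')
      · -- positive crossing: the current run `r` ends at the positive frontier vertex `x`
        exact ⟨piece u, u, x, r, hr, fun e he => Or.inl he, hu, hpos, hFu, hFx⟩

/-- **Runs lemma (discrete intermediate value along a walk through pieces).** Let the vertices of
`H` be distributed into pieces and labelled by integers; call a vertex *frontier* if it is an end of
the walk or adjacent to a vertex of another piece (`Fr`, any predicate with these two properties).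
If along the walk `w : x → y` every step between different pieces joins equal non-zero labels, and
`lab x < 0 < lab y`, then there are a piece `i` and a walk `q` inside piece `i`, using only edges of
`w`, from a frontier vertex of negative label to a frontier vertex of positive label. [folklore] -/
theorem exists_run_of_neg_of_pos (piece : X → ι) (lab : X → ℤ) (Fr : X → Prop)
    (hFr : ∀ z z' : X, H.Adj z z' → piece z ≠ piece z' → Fr z ∧ Fr z')
    {x y : X} (w : H.Walk x y) (hx : lab x < 0) (hy : 0 < lab y) (hFx : Fr x) (hFy : Fr y)
    (hcross : ∀ a b : X, s(a, b) ∈ w.edges → piece a ≠ piece b → lab a = lab b ∧ lab a ≠ 0) :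
    ∃ (i : ι) (a b : X) (q : H.Walk a b), (∀ z ∈ q.support, piece z = i) ∧
      (∀ e ∈ q.edges, e ∈ w.edges) ∧ lab a < 0 ∧ 0 < lab b ∧ Fr a ∧ Fr b := by
  obtain ⟨i, a, b, q, hq, hqe, ha, hb, hFa, hFb⟩ :=
    exists_run_of_neg_of_pos_aux piece lab Fr hFr hx hFx Walk.nil w
      (fun z hz => by rw [Walk.support_nil, List.mem_singleton] at hz; rw [hz]) hcross hy hFy
  refine ⟨i, a, b, q, hq, fun e he => ?_, ha, hb, hFa, hFb⟩
  rcases hqe e he with h | h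
  · simp at h
  · exact h

end Literature.Combinatorics.SimpleGraph
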